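import Summits.QuantumFields.BalabanUV.Beta.GAN24.FineInsertionVolumeLimit
import Summits.QuantumFields.BalabanUV.Beta.GAN24.DiagramVolumeLimitSandwich

/-!
# `BalabanUV.Beta.GAN24.EffectiveFormInsertionVolumeLimit` — binder row G-an2-4 ∕ (CONV-C), route R7 «TWO CURRENCIES», PART 147: THE u-DERIVATIVE SECTOR ON `ℤ^d` MODULO ONLY THE
# BACKGROUND's VOLUME LIMIT.  For the first-order model (`Pmodel V = Σ_μ diag(V_μ)·∇_μ`, NE2's `FirstOrderBackgroundModel`) with a volume-indexed family of Lipschitz backgrounds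
# `V_t` (constants `α, β` uniform in the volume) the tower `c_k⁻¹·[L^{dk}Q_k(𝒢^{(k)}P(V_t)𝒢^{(k)})Q_kᴴ]·c_k⁻¹` — PART 128's `Σ̇_k` up to sign, whose (UD)+(SR) in both currencies PART 126 ∕ 128
# proved volume-free — has the β-cell's whole `LimitRate` END on `ℤ^d` (`d ≥ 3`, `L ≥ 2`, `a > 0`, `μ ≠ ν`, even cubic volumes) as soon as the first-order coupling's fine entries converge at
# every pair of integer readings (EL₂ of `P(V_t)` — the background's infinite-volume limit, DISPLAYED): PART 126 (`decayStations_firstOrderInsertion_QB`, `n = 1`) for the insertion's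
# (UD)+(SR), PART 146 for its EL₂, PART 143's u-derivative socket for the sandwich (unit b2b-balaban-gan24-p3, gen 54; v1)

NOT IN PRINT; OUR PROOF ([folklore] bookkeeping BY NAME over PART 143 (`conv_insertion_invCov_of_kernel`), PART 146 (`tendsto_avgInsertion_pair`), PART 126 (`decayStations_firstOrderInsertion_QB`),
PART 128 (`entryDecay_of_le_rate`), PART 130 (`entryDecay_add`), PART 124 (`exists_admissible_rate`), NE2's `FirstOrderBackgroundModel` (`LipschitzBackground`, `Pmodel`, `firstOrder`),
`KingPairingPlantedLaw.calDalev_inv`, the β-cell's `DeltaACombesThomas.norm_fdiff_apply_le`; [Balaban1987RG1] (1.21)–(1.22) p. 264 LOCATE the shapes; nothing printed is a hypothesis).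
HONEST FRAMING (cell contract, verbatim): «discharging `BetaPertH` makes Bałaban's UV stability UNCONDITIONAL — a real constructive-QFT result; it is NOT the
continuum limit and NOT the Clay problem.»  HONEST DEPENDENCY (verbatim): «continuum YM on T⁴ ⇐ BetaPertH ∧ nine spine estimates (0/9 proved); BetaPertH ⇐
(D1) ∧ (D4) ∧ CAP+tail; G-an2-4 gates asym, D1 and NE2/3/4.»

WHAT THIS FILE PROVES (0 sorry, 0 `def`):
* §1 `norm_Pmodel_apply_le` (`‖P(V)^{(k)}(i,j)‖ ≤ d·(α·(2n_k))` from `LipschitzBackground.bound` and `norm_fdiff_apply_le`), `avgIns_eq` (the `n = 1` insertion chain of PART 126 IS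
  `k ↦ L^{dk}Q_k(𝒢P𝒢)Q_kᴴ`: `((Δ_a⁻¹P)^1Δ_a⁻¹ = 𝒢P𝒢`), **`insertion_decay_inputs`** (`L ≥ 2`, `d ≥ 1`: `∃ κ > 0, B, B′ ≥ 0` from `(d, L, a, α, β)` with (UD)+(SR) of the averaged insertion
  on EVERY torus for EVERY Lipschitz background with constants `α, β`).
* §2 **`conv_effIns_of_background`** — THE END: `V_t` Lipschitz backgrounds (`α, β` uniform) + EL₂ of `Pmodel (V_t) k` at fine integer pairs for every `k` ⟹ `∃ κ > 0, B, B′ ≥ 0, Π` with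
  `IsInfiniteVolumeLimit evenPeriod (Re (c_k⁻¹ X_t k c_k⁻¹)(e(·,μ′),e(0,ν′))) (Π k)`, `UniformDecay`, `StepRate (√(L⁻¹))`, `KernelInputs d Π`, `|secondMoment (Π k) μ ν − secondMoment Π_∞ μ ν| ≤ c₀(√(L⁻¹))^k`.
WHAT IT DOES NOT DO: supply the background's volume limit (external: the samples `V_t` of one `ℤ^d` connection would give it); identify the sign ∕ the exact `Σ̇` of PART 128 beyond the displayed
shape; `d ≤ 2`; odd volumes.  SUPPLIER work; NEVER «G-an2-4 closed»; NOT (CONV-C), NOT D1, NOT `BetaPertH`, NOT continuum, NOT Clay.  Records: `HOME/b2b-balaban-gan24-p3/gen54/README.md`.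
-/

noncomputable section

open scoped BigOperators ComplexConjugate Matrix Matrix.Norms.L2Operator
open Filter Topology

namespace Summit.QuantumFields.BalabanUV.Beta.GAN24.EffectiveFormInsertionVolumeLimit

open Literature.MathematicalPhysics.QuantumFieldTheory.Balaban1983to89
open Literature.MathematicalPhysics.QuantumFieldTheory.Balaban1983to89.B5Prop11Plancherel (Tor fine fdiff Cst)
open Literature.MathematicalPhysics.QuantumFieldTheory.Balaban1983to89.B5G183RateUnitTower (lev)
open Literature.MathematicalPhysics.QuantumFieldTheory.Balaban1983to89.B12Sec2to5 (l1 betaPrime510)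
open Literature.MathematicalPhysics.QuantumFieldTheory.Balaban1983to89.Beta (Site windowMap IsInfiniteVolumeLimit)
open Literature.MathematicalPhysics.QuantumFieldTheory.Balaban1983to89.Beta.FreeLegDictionary (cubic)
open Literature.MathematicalPhysics.QuantumFieldTheory.Balaban1983to89.Beta.BlockKernelVolumeSockets (evenPeriod tendsto_evenPeriod)
open Literature.MathematicalPhysics.QuantumFieldTheory.Balaban1983to89.Beta.VectorTails (castT)
open Literature.MathematicalPhysics.QuantumFieldTheory.Balaban1983to89.Beta.LimitRate (StepRate limKernelOf KernelInputs)
open Literature.MathematicalPhysics.QuantumFieldTheory.Balaban1983to89.Beta.DeltaACombesThomas (norm_fdiff_apply_le shiftEquiv)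
open Summit.QuantumFields.BalabanUV.T4Continuum
open Summit.QuantumFields.BalabanUV.T4Continuum.CovariantAveragingTower (Atow avgTow)
open Summit.QuantumFields.BalabanUV.T4Continuum.BalabanAveragedTowerUnit (idx QBlev calGlev unitCovB one_le_lev')
open Summit.QuantumFields.BalabanUV.T4Continuum.BalabanAveragedCoerciveTower (unitIdx)
open Summit.QuantumFields.BalabanUV.T4Continuum.KingPairingPlantedLaw (calDalev calDalev_inv CJ)
open Summit.QuantumFields.BalabanUV.T4Continuum.CTConjugatedHbd (G2)
open Summit.QuantumFields.BalabanUV.T4Continuum.FirstOrderBackgroundModel (LipschitzBackground Pmodel firstOrder C2model)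
open Summit.QuantumFields.BalabanUV.T4Continuum.CTKingTowerWeights (distK)
open Summit.QuantumFields.BalabanUV.T4Continuum.CTConjDefectDischarge (max_JA_lt_gamD)
open Summit.QuantumFields.BalabanUV.T4Continuum.DirichletRegionTower (gamD)
open Summit.QuantumFields.BalabanUV.T4Continuum.CTVectorPropagator (JA)
open Summit.QuantumFields.BalabanUV.T4Continuum.DecayRateInterpolation (EntryDecay DecayRate TwoLevelDecayRate)
open Summit.QuantumFields.BalabanUV.Beta.GAN24.DiagramDecayAlgebra (entryDecay_add)
open Summit.QuantumFields.BalabanUV.Beta.GAN24.UnitLatticeDecayAlgebra (distK_nonneg)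
open Summit.QuantumFields.BalabanUV.Beta.GAN24.EffectiveFormDecay (entryDecay_of_le_rate)
open Summit.QuantumFields.BalabanUV.Beta.GAN24.InsertionChainDecay (exists_admissible_rate)
open Summit.QuantumFields.BalabanUV.Beta.GAN24.InsertionChainDecayBalaban (decayStations_firstOrderInsertion_QB)
open Summit.QuantumFields.BalabanUV.Beta.GAN24.DiagramVolumeLimitSandwich (conv_insertion_invCov_of_kernel)
open Summit.QuantumFields.BalabanUV.Beta.GAN24.FineInsertionVolumeLimit (tendsto_avgInsertion_pair)

variable {d : ℕ} (L : ℕ) [NeZero L]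

/-! ## §1 The first-order coupling is entrywise bounded; the averaged insertion's (UD)+(SR), volume-free -/

section Inputs

variable (M : Fin d → ℕ) [hM : ∀ μ, NeZero (M μ)] (a : ℝ) (ha : 0 < a)

/-- **`‖P(V)^{(k)}(i,j)‖ ≤ d·(α·(2n_k))`**: the first-order coupling `Σ_μ diag(V_μ)·∇_μ` of a background of size `≤ α` has entries bounded by `d·α·2n_k` (each `∇_μ` has entries of modulus
`≤ 2n_k`). [folklore] -/
theorem norm_Pmodel_apply_le {V : (k : ℕ) → Fin d → (idx L M k → ℂ)} {α β : ℝ} (hV : LipschitzBackground L M V α β) (k : ℕ) (i j : idx L M k) :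
    ‖Pmodel L M V k i j‖ ≤ d * (α * (2 * lev L k)) := by
  unfold Pmodel firstOrder
  rw [Matrix.sum_apply]
  calc ‖∑ μ, (Matrix.diagonal (V k μ) * fdiff (fine (lev L k) M) ((lev L k : ℕ) : ℂ) μ) i j‖
      ≤ ∑ μ, ‖(Matrix.diagonal (V k μ) * fdiff (fine (lev L k) M) ((lev L k : ℕ) : ℂ) μ) i j‖ := norm_sum_le _ _
    _ ≤ ∑ _μ : Fin d, α * (2 * lev L k) := by
        refine Finset.sum_le_sum fun μ _ => ?_
        rw [Matrix.diagonal_mul, norm_mul]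
        have h1 := hV.bound k μ i
        have h2 : ‖fdiff (fine (lev L k) M) ((lev L k : ℕ) : ℂ) μ i j‖ ≤ 2 * lev L k := by
          refine (norm_fdiff_apply_le (fine (lev L k) M) ((lev L k : ℕ) : ℂ) μ i j).trans ?_
          rw [Complex.norm_natCast]
          have : ((if j = shiftEquiv (fine (lev L k) M) μ i then (1 : ℝ) else 0) + (if j = i then 1 else 0)) ≤ 2 := by
            split_ifs <;> norm_num
          calc (lev L k : ℝ) * _ ≤ (lev L k : ℝ) * 2 := mul_le_mul_of_nonneg_left this (Nat.cast_nonneg _)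
            _ = 2 * lev L k := mul_comm _ _
        exact mul_le_mul h1 h2 (norm_nonneg _) hV.nonneg.1
    _ = d * (α * (2 * lev L k)) := by rw [Finset.sum_const, Finset.card_univ, Fintype.card_fin, nsmul_eq_mul]

/-- the `n = 1` insertion chain of PART 126 IS the averaged insertion `k ↦ L^{dk}Q_k(𝒢^{(k)}P𝒢^{(k)})Q_kᴴ` (`((Δ_a⁻¹P)^1)Δ_a⁻¹ = 𝒢P𝒢`, `calDalev_inv`). [folklore] -/
theorem avgIns_eq (V : (k : ℕ) → Fin d → (idx L M k → ℂ)) :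
    avgTow (QBlev L M) ((L : ℝ) ^ d) (fun k => ((calDalev L M a ha k)⁻¹ * Pmodel L M V k) ^ 1 * (calDalev L M a ha k)⁻¹)
      = avgTow (QBlev L M) ((L : ℝ) ^ d) (fun k => calGlev L M a ha k * Pmodel L M V k * calGlev L M a ha k) := by
  funext k
  simp only [avgTow, pow_one, calDalev_inv]

/-- **`insertion_decay_inputs` — (UD)+(SR) OF THE AVERAGED INSERTION, VOLUME-FREE, FOR EVERY LIPSCHITZ BACKGROUND** (`L ≥ 2`, `d ≥ 1`): `∃ κ > 0, B, B′ ≥ 0` depending on `(d, L, a, α, β)`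
only such that for EVERY torus `M` and EVERY background `V` with `LipschitzBackground L M V α β`: (UD) `EntryDecay distK (X_k) B κ` for all `k` and (SR) `TwoLevelDecayRate distK X B′ κ (√(L⁻¹))`,
`X_k = L^{dk}Q_k(𝒢^{(k)}P(V)𝒢^{(k)})Q_kᴴ` — PART 126's `decayStations_firstOrderInsertion_QB` at `n = 1` and an admissible rate, (UD) from the limit decay plus the `DecayRate` clause. -/
theorem insertion_decay_inputs (hL : 2 ≤ L) (hd : 1 ≤ d) (α β : ℝ) :
    ∃ κ B B' : ℝ, 0 < κ ∧ 0 ≤ B ∧ 0 ≤ B' ∧ ∀ (M : Fin d → ℕ) [∀ μ, NeZero (M μ)] (V : (k : ℕ) → Fin d → (idx L M k → ℂ)), LipschitzBackground L M V α β →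
      (∀ k, EntryDecay (distK L M) (avgTow (QBlev L M) ((L : ℝ) ^ d) (fun k => calGlev L M a ha k * Pmodel L M V k * calGlev L M a ha k) k) B κ) ∧
      TwoLevelDecayRate (distK L M) (avgTow (QBlev L M) ((L : ℝ) ^ d) (fun k => calGlev L M a ha k * Pmodel L M V k * calGlev L M a ha k)) B' κ (Real.sqrt ((L : ℝ)⁻¹)) := by
  obtain ⟨κ, hκ0, -, hγ', hδ', hJA⟩ := exists_admissible_rate d a
  have hJγ : max (JA d a 1 κ 1) 0 < gamD d a := max_JA_lt_gamD a hJA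
  -- the constants of PART 126 at `n = 1`, `a′ = 1`
  set Bl : ℝ := (gamD d a - max (JA d a 1 κ 1) 0)⁻¹ * (d * (α * G2 d a (max (JA d a 1 κ 1) 0) (gamD d a - max (JA d a 1 κ 1) 0) κ)) ^ 1 * Real.exp (κ * 4) with hBl
  set R : ℝ := Real.sqrt (2 * ((gamD d a - max (JA d a 1 κ 1) 0)⁻¹
      * (d * (α * G2 d a (max (JA d a 1 κ 1) 0) (gamD d a - max (JA d a 1 κ 1) 0) κ)) ^ 1 * Real.exp (κ * 4))
    * ((((((1 : ℕ) : ℝ) + 1) * (d * (α + β) * Cst d a) ^ 1 * CJ d a + ((1 : ℕ) : ℝ) * (d * (α + β) * Cst d a) ^ (1 - 1) * C2model d L a α β)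
        + (d * (α + β) * Cst d a) ^ 1 * (2 * d * Cst d a + 2 * (d * L * Cst d a))) / (1 - (L : ℝ)⁻¹))) with hR
  set R' : ℝ := Real.sqrt (2 * ((gamD d a - max (JA d a 1 κ 1) 0)⁻¹
      * (d * (α * G2 d a (max (JA d a 1 κ 1) 0) (gamD d a - max (JA d a 1 κ 1) 0) κ)) ^ 1 * Real.exp (κ * 4))
    * (2 * (((((1 : ℕ) : ℝ) + 1) * (d * (α + β) * Cst d a) ^ 1 * CJ d a + ((1 : ℕ) : ℝ) * (d * (α + β) * Cst d a) ^ (1 - 1) * C2model d L a α β)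
        + (d * (α + β) * Cst d a) ^ 1 * (2 * d * Cst d a + 2 * (d * L * Cst d a))) / (1 - (L : ℝ)⁻¹))) with hR'
  have hθ0 : 0 ≤ Real.sqrt ((L : ℝ)⁻¹) := Real.sqrt_nonneg _
  have hθ1 : Real.sqrt ((L : ℝ)⁻¹) ≤ 1 := by
    rw [Real.sqrt_le_one]; exact inv_le_one_of_one_le₀ (by exact_mod_cast le_trans one_le_two hL)
  refine ⟨κ / 2, max Bl 0 + R, R', half_pos hκ0, add_nonneg (le_max_right _ _) (Real.sqrt_nonneg _), Real.sqrt_nonneg _, fun M _ V hV => ?_⟩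
  obtain ⟨clim, -, hlim, hrate, hstep⟩ := decayStations_firstOrderInsertion_QB L M a ha hL hd hV one_pos hκ0.le hγ' hδ' hJA 1
  rw [avgIns_eq L M a ha V] at hrate hstep
  refine ⟨fun k => ?_, hstep⟩
  have hlim' : EntryDecay (distK L M) clim (max Bl 0) κ := fun x y => (hlim x y).trans (mul_le_mul_of_nonneg_right (le_max_left _ _) (Real.exp_pos _).le)
  have h1 : EntryDecay (distK L M) clim (max Bl 0) (κ / 2) := entryDecay_of_le_rate (distK_nonneg L M) hlim' (le_max_right _ _) (half_le_self hκ0.le)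
  have h2 : EntryDecay (distK L M) (avgTow (QBlev L M) ((L : ℝ) ^ d) (fun k => calGlev L M a ha k * Pmodel L M V k * calGlev L M a ha k) k - clim) R (κ / 2) := fun x y =>
    (hrate k x y).trans (mul_le_mul_of_nonneg_right (mul_le_of_le_one_right (Real.sqrt_nonneg _) (pow_le_one₀ hθ0 hθ1)) (Real.exp_pos _).le)
  have e : avgTow (QBlev L M) ((L : ℝ) ^ d) (fun k => calGlev L M a ha k * Pmodel L M V k * calGlev L M a ha k) k
      = clim + (avgTow (QBlev L M) ((L : ℝ) ^ d) (fun k => calGlev L M a ha k * Pmodel L M V k * calGlev L M a ha k) k - clim) := by abel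
  rw [e]
  exact entryDecay_add h1 h2

end Inputs

/-! ## §2 The u-derivative sector on `ℤ^d`, modulo the background's volume limit -/

variable (a : ℝ) (ha : 0 < a)

/-- **`conv_effIns_of_background` — THE u-DERIVATIVE SECTOR ON `ℤ^d`, MODULO ONLY THE BACKGROUND's VOLUME LIMIT** [our proof] (`d ≥ 3`, `L ≥ 2`, `a > 0`, `μ ≠ ν`, along the even cubic
volumes `side t = 2(t+1)`): for a volume-indexed family of backgrounds `V_t` with `LipschitzBackground L (cubic d (2(t+1))) (V t) α β` (constants uniform in the volume) whose first-order couplings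
`P(V_t)^{(k)}` have fine entries converging at every pair of integer readings for every level `k` (DISPLAYED — the background's infinite-volume limit), the tower
`c_k⁻¹·[L^{dk}Q_k(𝒢^{(k)}P(V_t)𝒢^{(k)})Q_kᴴ]·c_k⁻¹` (PART 128's `Σ̇_k` up to sign) has: limit kernels `Π_k` (`IsInfiniteVolumeLimit`), `UniformDecay Π μ ν B (κ∕d)`, `StepRate Π μ ν B′ (κ∕d) (√(L⁻¹))`,
`KernelInputs d Π`, and `∀ k, |secondMoment (Π k) μ ν − secondMoment (limKernelOf Π) μ ν| ≤ β′_d(B′∕(1−√(L⁻¹)), κ∕d)·(√(L⁻¹))^k`, with `κ > 0`, `B, B′ ≥ 0` from `(d, L, a, α, β)` — PART 143's socket on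
§1's (UD)+(SR) and PART 146's EL₂. [cite: Balaban1987RG1, (1.21)–(1.22) p.264 (shapes)] -/
theorem conv_effIns_of_background (hL : 2 ≤ L) (hd : 3 ≤ d) {μ ν : Fin d} (hne : μ ≠ ν) {α β : ℝ}
    {V : (t : ℕ) → (k : ℕ) → Fin d → (idx L (cubic d (evenPeriod t)) k → ℂ)} (hV : ∀ t, LipschitzBackground L (cubic d (evenPeriod t)) (V t) α β)
    (hPel : ∀ k (f g : Fin d) (z z' : Fin d → ℤ), ∃ s : ℂ,
      Tendsto (fun t => Pmodel L (cubic d (evenPeriod t)) (V t) k (castT (cubic d (lev L k * evenPeriod t)) z, f) (castT (cubic d (lev L k * evenPeriod t)) z', g)) atTop (𝓝 s)) :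
    ∃ κ B B' : ℝ, 0 < κ ∧ 0 ≤ B ∧ 0 ≤ B' ∧ ∃ Pinf : ℕ → B12Beta.Kernel d,
      (∀ k, IsInfiniteVolumeLimit evenPeriod
        (fun t μ' ν' (z : Site d (evenPeriod t)) => (((unitCovB L (cubic d (evenPeriod t)) a ha k)⁻¹
            * avgTow (QBlev L (cubic d (evenPeriod t))) ((L : ℝ) ^ d)
                (fun k' => calGlev L (cubic d (evenPeriod t)) a ha k' * Pmodel L (cubic d (evenPeriod t)) (V t) k' * calGlev L (cubic d (evenPeriod t)) a ha k') k
            * (unitCovB L (cubic d (evenPeriod t)) a ha k)⁻¹)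
          ((unitIdx L (cubic d (evenPeriod t))).symm (z, μ')) ((unitIdx L (cubic d (evenPeriod t))).symm (0, ν'))).re) (Pinf k)) ∧
      Beta.LimitRate.UniformDecay Pinf μ ν B (κ / d) ∧ StepRate Pinf μ ν B' (κ / d) (Real.sqrt ((L : ℝ)⁻¹)) ∧
      (∃ K : KernelInputs d Pinf, K.θ = Real.sqrt ((L : ℝ)⁻¹) ∧ K.c₀ = betaPrime510 d (B' / (1 - Real.sqrt ((L : ℝ)⁻¹))) (κ / d) ∧ K.Pinf = limKernelOf Pinf ∧ K.μ = μ ∧ K.ν = ν) ∧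
      (∀ k, |B12Beta.secondMoment (Pinf k) μ ν - B12Beta.secondMoment (limKernelOf Pinf) μ ν|
          ≤ betaPrime510 d (B' / (1 - Real.sqrt ((L : ℝ)⁻¹))) (κ / d) * Real.sqrt ((L : ℝ)⁻¹) ^ k) := by
  have hd1 : 1 ≤ d := le_trans (by norm_num) hd
  have hαβ : 0 ≤ α ∧ 0 ≤ β := (hV 0).nonneg
  obtain ⟨κ, B, B', hκ, hB, hB', h⟩ := insertion_decay_inputs L a ha hL hd1 α β
  refine conv_insertion_invCov_of_kernel L a ha hL hd hne
    (X := fun t k => avgTow (QBlev L (cubic d (evenPeriod t))) ((L : ℝ) ^ d)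
      (fun k' => calGlev L (cubic d (evenPeriod t)) a ha k' * Pmodel L (cubic d (evenPeriod t)) (V t) k' * calGlev L (cubic d (evenPeriod t)) a ha k') k)
    hκ hB hB' (fun t k => (h (cubic d (evenPeriod t)) (V t) (hV t)).1 k) (fun t => (h (cubic d (evenPeriod t)) (V t) (hV t)).2) ?_
  intro k f g z z'
  have hb0 : 0 ≤ d * (α * (2 * lev L k)) := by have := hαβ.1; positivity
  exact tendsto_avgInsertion_pair L a ha hd k (P := fun t k' => Pmodel L (cubic d (evenPeriod t)) (V t) k') hb0
    (fun t w g' y h' => norm_Pmodel_apply_le L (cubic d (evenPeriod t)) (hV t) k _ _) (hPel k) f g z z'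

end Summit.QuantumFields.BalabanUV.Beta.GAN24.EffectiveFormInsertionVolumeLimit

end
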